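import Summits.QuantumFields.YangMills.Theorems.IR.TelescopedCodingCompose

/-!
# S₂∕C3 (1/4): exact `t`-fold nesting of `blockField` on odd tori

Landing file 1/4 of the S₂∕C3 development of line `smallfield-polymer-coder` (crux `BalabanLadder.IR`, stmt-QuantumFields-19354;
ideator ym-ir-idea-4 g4, 2026-08-28): the floored iteration of conditional coders `IterateCondCoders` with level-independent
constants (S₂) and the guarded one-step conditional composition over a general divisor `M' ∣ M` (C3, `1 ≤ M`), both PROVED
(`iterateCondCoders_holds`, `composeCond_pos`, file 4).  VERBATIM from `Cruxes/IR/Lines/smallfield_polymer_coder.lean` rev 6 §2b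
(namespace kept: `Summit.QuantumFields.YangMills.Cruxes.IR.SmallFieldPolymerCoder`).  Pure measure theory ∕ arithmetic over the
tree's `Theorems/IR/TelescopedCoding*` API; sorry-free.  HONESTY: plumbing only — nothing here bears on the Yang–Mills mass gap (Clay),
a lattice gap or `BalabanLadder.IR`; R4 of the ladder closes only the conditional finite-𝕋⁴ rung `BalabanLadder.UV`.
-/

set_option autoImplicit false

noncomputable section

open MeasureTheory
open Literature.MathematicalPhysics.QuantumFieldTheory Literature.MathematicalPhysics.QuantumLattice
open Summit.QuantumFields.YangMills.Cruxes.IR.TelescopedCoding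

namespace Summit.QuantumFields.YangMills.Cruxes.IR.SmallFieldPolymerCoder

/-! ## §S2.1 Block bases, natural links, exact `t`-fold nesting of `blockField` (`nestMul`, `blockField_mul`) -/

section Nesting

variable {G : Type}

/-- Base point (natural coordinates `M ⌊x_l / M⌋`) of the `M`-block containing the site of `q`. -/
def blockBase (M N : ℕ) (q : Edge 4 N) : Fin 4 → ℕ := fun l => M * ((q.1 l).val / M)

/-- The torus link at natural coordinates `c`, direction `i`. -/
def natLink (N : ℕ) (c : Fin 4 → ℕ) (i : Fin 4) : Edge 4 N := (fun l => ((c l : ℕ) : ZMod N), i)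

theorem natLink_snd (N : ℕ) (c : Fin 4 → ℕ) (i : Fin 4) : (natLink N c i).2 = i := rfl

theorem natLink_val {N : ℕ} [NeZero N] {c : Fin 4 → ℕ} (hc : ∀ l, c l < N) (i l : Fin 4) :
    ((natLink N c i).1 l).val = c l := by
  simp only [natLink, ZMod.val_natCast, Nat.mod_eq_of_lt (hc l)]

theorem blockField_eq_prod [Group G] (M N : ℕ) (U : GaugeConfig 4 N G) (q : Edge 4 N) :
    blockField M N U q = (((List.range M).filter fun j => blockBase M N q q.2 + j < N).map fun j =>
      U (torusEdge N ((fun l => ((blockBase M N q l : ℕ) : ℤ)) + Pi.single q.2 (j : ℤ), q.2))).prod := rfl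

/-- `blockField` in normal form: a product over a list of NATURAL offsets (the definition's list carries a coercion
through the `List` monad). -/
theorem blockField_apply' [Group G] (M N : ℕ) (U : GaugeConfig 4 N G) (q : Edge 4 N) :
    blockField M N U q = (((List.range M).filter fun j => blockBase M N q q.2 + j < N).map fun j : ℕ =>
      U (torusEdge N ((fun l => ((blockBase M N q l : ℕ) : ℤ)) + Pi.single q.2 ((j : ℕ) : ℤ), q.2))).prod := by
  rw [blockField_eq_prod]
  simp only [bind_pure_comp, List.map_eq_map, List.map_map]
  rfl

/-- The block base of a link sitting at an `M`-corner with in-range coordinates is that corner. -/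
theorem blockBase_natLink {M N : ℕ} [NeZero N] {c : Fin 4 → ℕ} (hc : ∀ l, c l < N) (hdiv : ∀ l, M ∣ c l)
    (i : Fin 4) : blockBase M N (natLink N c i) = c := by
  funext l
  simp only [blockBase, natLink_val hc, Nat.mul_div_cancel' (hdiv l)]

theorem blockBase_lt {M N : ℕ} [NeZero N] (q : Edge 4 N) (l : Fin 4) : blockBase M N q l < N :=
  lt_of_le_of_lt (Nat.mul_div_le _ _) (ZMod.val_lt _)

theorem dvd_blockBase (M N : ℕ) (q : Edge 4 N) (l : Fin 4) : M ∣ blockBase M N q l := ⟨_, rfl⟩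

/-- `blockField 1` is the identity. -/
theorem blockField_one [Group G] {N : ℕ} [NeZero N] (U : GaugeConfig 4 N G) : blockField 1 N U = U := by
  funext q
  rw [blockField_apply']
  have hb : ∀ l, blockBase 1 N q l = (q.1 l).val := fun l => by simp [blockBase]
  have hfilt : ((List.range 1).filter fun j => blockBase 1 N q q.2 + j < N) = [(0 : ℕ)] := by
    rw [List.range_one, List.filter_singleton]
    have : decide (blockBase 1 N q q.2 + 0 < N) = true := by
      rw [decide_eq_true_eq, hb, add_zero]; exact ZMod.val_lt _
    rw [this]; rfl
  rw [hfilt]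
  simp only [List.map_cons, List.map_nil, List.prod_cons, List.prod_nil, mul_one]
  congr 1
  refine Prod.ext ?_ rfl
  funext l
  simp only [torusEdge, Literature.Probability.LatticeModels.Torus.proj, Pi.add_apply, hb, Nat.cast_zero, Pi.single_zero,
    Pi.zero_apply, add_zero, Int.cast_natCast, ZMod.natCast_zmod_val]

/-- **General nesting map**: the `tM`-block field as a function of the `M`-block field `W` — the product of the `M`-block values at
the `t` consecutive `M`-corners of the `tM`-block line, dropping those that start outside the fundamental domain. -/
def nestMul [Group G] (t M N : ℕ) (W : GaugeConfig 4 N G) : GaugeConfig 4 N G := fun q =>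
  (((List.range t).filter fun m => blockBase (t * M) N q q.2 + m * M < N).map fun m : ℕ =>
      W (natLink N (blockBase (t * M) N q + Pi.single q.2 (m * M)) q.2)).prod

theorem measurable_nestMul [Group G] [MeasurableSpace G] [MeasurableMul₂ G] (t M N : ℕ) :
    Measurable (nestMul (G := G) t M N) := by
  refine measurable_pi_lambda _ fun q => ?_
  have h : (fun W : GaugeConfig 4 N G => nestMul t M N W q) = fun W =>
      ((((List.range t).filter fun m => blockBase (t * M) N q q.2 + m * M < N).map
        fun (m : ℕ) (W : GaugeConfig 4 N G) => W (natLink N (blockBase (t * M) N q + Pi.single q.2 (m * M)) q.2)).map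
        fun f => f W).prod := by
    funext W; simp only [nestMul, List.map_map]; rfl
  rw [h]
  refine List.measurable_fun_prod _ fun f hf => ?_
  obtain ⟨m, -, rfl⟩ := List.mem_map.1 hf
  exact measurable_pi_apply _

/-- One straight line of `t·M` links from an `M`-corner `c` in direction `i` (truncated at the domain edge) is the product of
the `t` consecutive `M`-block values along it. -/
theorem blockLine_aux [Group G] {M N : ℕ} [NeZero N] (U : GaugeConfig 4 N G) (c : Fin 4 → ℕ)
    (hcN : ∀ l, c l < N) (hcM : ∀ l, M ∣ c l) (i : Fin 4) (t : ℕ) :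
    (((List.range (t * M)).filter fun j => c i + j < N).map fun j : ℕ =>
        U (torusEdge N ((fun l => ((c l : ℕ) : ℤ)) + Pi.single i ((j : ℕ) : ℤ), i))).prod =
    (((List.range t).filter fun m => c i + m * M < N).map fun m : ℕ =>
        blockField M N U (natLink N (c + Pi.single i (m * M)) i)).prod := by
  set f : ℕ → G := fun j => U (torusEdge N ((fun l => ((c l : ℕ) : ℤ)) + Pi.single i ((j : ℕ) : ℤ), i)) with hf
  induction t with
  | zero => simp
  | succ t ih =>
    have hr : List.range ((t + 1) * M) = List.range (t * M) ++ (List.range M).map (fun j => t * M + j) := by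
      rw [Nat.succ_mul, List.range_add]
    rw [hr, List.filter_append, List.map_append, List.prod_append, ih, List.range_succ, List.filter_append,
      List.map_append, List.prod_append]
    congr 1
    set c' : Fin 4 → ℕ := c + Pi.single i (t * M) with hc'
    rw [List.filter_map, List.map_map, List.filter_singleton]
    by_cases hlt : c i + t * M < N
    · rw [decide_eq_true hlt]
      simp only [cond_true, List.map_cons, List.map_nil, List.prod_cons, List.prod_nil, mul_one]
      rw [blockField_apply', natLink_snd]
      have hc'N : ∀ l, c' l < N := by
        intro l
        by_cases hl : l = i
        · rw [hl]; simpa [hc'] using hlt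
        · simp only [hc', Pi.add_apply, Pi.single_eq_of_ne hl, add_zero]; exact hcN l
      have hc'M : ∀ l, M ∣ c' l := by
        intro l
        by_cases hl : l = i
        · rw [hl]; simpa [hc'] using (hcM i).add (Dvd.intro_left t rfl)
        · simp only [hc', Pi.add_apply, Pi.single_eq_of_ne hl, add_zero]; exact hcM l
      rw [blockBase_natLink hc'N hc'M]
      have hpred : ((fun j => decide (c i + j < N)) ∘ fun j => t * M + j) = fun j => decide (c' i + j < N) := by
        funext j; simp only [Function.comp, hc', Pi.add_apply, Pi.single_eq_same, add_assoc]
      have hsum : (f ∘ fun j => t * M + j) = fun j : ℕ =>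
          U (torusEdge N ((fun l => ((c' l : ℕ) : ℤ)) + Pi.single i (j : ℤ), i)) := by
        funext j
        simp only [Function.comp, hf]
        congr 2
        refine Prod.ext ?_ rfl
        funext l
        by_cases hl : l = i
        · rw [hl]; simp only [hc', Pi.add_apply, Pi.single_eq_same]; push_cast; ring
        · simp only [hc', Pi.add_apply, Pi.single_eq_of_ne hl, add_zero]
      rw [hpred, hsum]
    · have hd : decide (c i + t * M < N) = false := decide_eq_false hlt
      rw [hd]
      simp only [cond_false, List.map_nil, List.prod_nil]
      have hnil : ((List.range M).filter ((fun j => decide (c i + j < N)) ∘ fun j => t * M + j)) = [] := by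
        rw [List.filter_eq_nil_iff]
        intro j _
        simp only [Function.comp, decide_eq_true_eq, not_lt]
        omega
      rw [hnil, List.map_nil, List.prod_nil]

/-- **`blockField` nests exactly under any integer coarsening of the block side** (odd or even torus, any `M > 0`, any `t`). -/
theorem blockField_mul [Group G] {t M N : ℕ} [NeZero N] (hM : 0 < M) (U : GaugeConfig 4 N G) :
    blockField (t * M) N U = nestMul t M N (blockField M N U) := by
  funext q
  simp only [nestMul]
  rw [blockField_apply' (t * M)]
  exact blockLine_aux U (blockBase (t * M) N q) (fun l => blockBase_lt q l)
    (fun l => (Dvd.intro_left t rfl : M ∣ t * M).trans (dvd_blockBase (t * M) N q l)) q.2 t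

end Nesting
/-! ## §S2.2 Measurability of the block field; the law identity of a two-level conditional composition -/

section LawStep

variable {G : Type} [Group G] [TopologicalSpace G] [IsTopologicalGroup G] [CompactSpace G]
  [MeasurableSpace G] [BorelSpace G] [SecondCountableTopology G]

/-- The block-holonomy field is measurable (finite products of evaluations; `G` second countable). -/
theorem measurable_blockField (M N : ℕ) : Measurable (blockField (G := G) M N) := by
  refine measurable_pi_lambda _ fun q => ?_
  have h : (fun U : GaugeConfig 4 N G => blockField M N U q) = fun U =>
      ((((List.range M).filter fun j => blockBase M N q q.2 + j < N).map fun (j : ℕ) (U : GaugeConfig 4 N G) =>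
        U (torusEdge N ((fun l => ((blockBase M N q l : ℕ) : ℤ)) + Pi.single q.2 ((j : ℕ) : ℤ), q.2))).map
        fun f => f U).prod := by
    funext U; rw [blockField_apply', List.map_map]; rfl
  rw [h]
  refine List.measurable_fun_prod _ fun f hf => ?_
  obtain ⟨j, -, rfl⟩ := List.mem_map.1 hf
  exact measurable_pi_apply _

variable {N : ℕ} (ρ : G →* Matrix (Fin N) (Fin N) ℂ) (β : ℝ)

/-- **Law step.** If `C` samples the fine field given its `M`-block field and `B` samples the `M`-block field given the
`2M`-block field (exact conditional samplers driven by independent sequence noises), then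
`(V, ω) ↦ C (reblock M (B (V, ω_even)), ω_odd)` samples the fine field given its `2M`-block field.  Pure measure algebra
over the exact nesting `blockField (tM) = nestMul t M ∘ blockField M`. -/
theorem condLaw_step {S M t : ℕ} (hM : 0 < M)
    {C B : GaugeConfig 4 (2 * S + 1) G × Noise G (2 * S + 1) → GaugeConfig 4 (2 * S + 1) G}
    (hC : Measurable C) (hB : Measurable B)
    (hClaw : (((wilsonMeasure (d := 4) (L := 2 * S + 1) ρ β).map (blockField M (2 * S + 1))).prod
        (seqNoise G (2 * S + 1))).map (fun p => (p.1, C p)) =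
      (wilsonMeasure (d := 4) (L := 2 * S + 1) ρ β).map (fun U => (blockField M (2 * S + 1) U, U)))
    (hBlaw : (((wilsonMeasure (d := 4) (L := 2 * S + 1) ρ β).map (blockField (t * M) (2 * S + 1))).prod
        (seqNoise G (2 * S + 1))).map (fun p => (p.1, B p)) =
      (wilsonMeasure (d := 4) (L := 2 * S + 1) ρ β).map
        (fun U => (blockField (t * M) (2 * S + 1) U, blockField M (2 * S + 1) U))) :
    (((wilsonMeasure (d := 4) (L := 2 * S + 1) ρ β).map (blockField (t * M) (2 * S + 1))).prod
        (seqNoise G (2 * S + 1))).map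
        (fun p => (p.1, C (reblock M (2 * S + 1) (B (p.1, evenPart p.2)), oddPart p.2))) =
      (wilsonMeasure (d := 4) (L := 2 * S + 1) ρ β).map (fun U => (blockField (t * M) (2 * S + 1) U, U)) := by
  haveI : IsProbabilityMeasure (seqNoise G (2 * S + 1)) := isProbabilityMeasure_seqNoise _
  haveI : SFinite (wilsonMeasure (d := 4) (L := 2 * S + 1) ρ β) := by
    unfold wilsonMeasure wilsonWeight; infer_instance
  -- names
  set μ : Measure (GaugeConfig 4 (2 * S + 1) G) := wilsonMeasure (d := 4) (L := 2 * S + 1) ρ β with hμ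
  set ν : Measure (Noise G (2 * S + 1)) := seqNoise G (2 * S + 1) with hν
  have hbf : ∀ M', Measurable (blockField (G := G) M' (2 * S + 1)) := fun M' => measurable_blockField M' _
  have hrb : Measurable (reblock (G := G) M (2 * S + 1)) := measurable_reblock _ _
  have hn2 : Measurable (nestMul (G := G) t M (2 * S + 1)) := measurable_nestMul _ _ _
  -- the three maps
  set g : GaugeConfig 4 (2 * S + 1) G × Noise G (2 * S + 1) → GaugeConfig 4 (2 * S + 1) G × GaugeConfig 4 (2 * S + 1) G :=
    fun p => (p.1, reblock M (2 * S + 1) (B p)) with hg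
  have hgm : Measurable g := measurable_fst.prodMk (hrb.comp hB)
  set F : GaugeConfig 4 (2 * S + 1) G × Noise G (2 * S + 1) →
      (GaugeConfig 4 (2 * S + 1) G × GaugeConfig 4 (2 * S + 1) G) × Noise G (2 * S + 1) :=
    fun p => ((p.1, reblock M (2 * S + 1) (B (p.1, evenPart p.2))), oddPart p.2) with hF
  set H : (GaugeConfig 4 (2 * S + 1) G × GaugeConfig 4 (2 * S + 1) G) × Noise G (2 * S + 1) →
      GaugeConfig 4 (2 * S + 1) G × GaugeConfig 4 (2 * S + 1) G := fun r => (r.1.1, C (r.1.2, r.2)) with hH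
  have hHm : Measurable H := (measurable_fst.comp measurable_fst).prodMk
    (hC.comp ((measurable_snd.comp measurable_fst).prodMk measurable_snd))
  have hFeq : F = ((Prod.map g id) ∘ ⇑(MeasurableEquiv.prodAssoc.symm)) ∘ (Prod.map id splitNoise) := by
    funext p; rfl
  have hFm : Measurable F := by
    rw [hFeq]
    exact (hgm.prodMap measurable_id).comp
      ((MeasurableEquiv.prodAssoc.symm).measurable.comp (measurable_id.prodMap measurable_splitNoise))
  have htarget : (fun p : GaugeConfig 4 (2 * S + 1) G × Noise G (2 * S + 1) =>
      (p.1, C (reblock M (2 * S + 1) (B (p.1, evenPart p.2)), oddPart p.2))) = H ∘ F := by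
    funext p; rfl
  -- Claim 1: the law of `F`
  have hτ : (((μ.map (blockField (t * M) (2 * S + 1))).prod ν).map g) =
      μ.map (fun U => (blockField (t * M) (2 * S + 1) U, blockField M (2 * S + 1) U)) := by
    have hg' : g = (Prod.map id (reblock M (2 * S + 1))) ∘ (fun p => (p.1, B p)) := by funext p; rfl
    rw [hg', ← Measure.map_map (measurable_id.prodMap hrb) (measurable_fst.prodMk hB), hBlaw,
      Measure.map_map (measurable_id.prodMap hrb) ((hbf _).prodMk (hbf _))]
    have hfun : (Prod.map id (reblock M (2 * S + 1))) ∘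
        (fun U : GaugeConfig 4 (2 * S + 1) G => (blockField (t * M) (2 * S + 1) U, blockField M (2 * S + 1) U)) =
        fun U => (blockField (t * M) (2 * S + 1) U, blockField M (2 * S + 1) U) := by
      funext U; simp only [Function.comp, Prod.map, id, reblock_blockField hM]
    rw [hfun]
  have h1 : ((μ.map (blockField (t * M) (2 * S + 1))).prod ν).map F =
      (μ.map (fun U => (blockField (t * M) (2 * S + 1) U, blockField M (2 * S + 1) U))).prod ν := by
    rw [hFeq, ← Measure.map_map ((hgm.prodMap measurable_id).comp (MeasurableEquiv.prodAssoc.symm).measurable)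
      (measurable_id.prodMap measurable_splitNoise)]
    rw [← Measure.map_prod_map _ _ measurable_id measurable_splitNoise, Measure.map_id, seqNoise_map_splitNoise]
    rw [← Measure.map_map (hgm.prodMap measurable_id) (MeasurableEquiv.prodAssoc.symm).measurable]
    rw [((MeasureTheory.measurePreserving_prodAssoc (μ.map (blockField (t * M) (2 * S + 1))) ν ν).symm
      MeasurableEquiv.prodAssoc).map_eq]
    rw [← Measure.map_prod_map _ _ hgm measurable_id, Measure.map_id, hτ]
  -- Claim 2: `τ ⊗ ν` from the `M`-level pair law via nesting
  have hnm : Measurable (fun W : GaugeConfig 4 (2 * S + 1) G => (nestMul t M (2 * S + 1) W, W)) :=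
    hn2.prodMk measurable_id'
  have h2 : (μ.map (fun U => (blockField (t * M) (2 * S + 1) U, blockField M (2 * S + 1) U))).prod ν =
      ((μ.map (blockField M (2 * S + 1))).prod ν).map
        (Prod.map (fun W => (nestMul t M (2 * S + 1) W, W)) id) := by
    rw [← Measure.map_prod_map _ _ hnm measurable_id, Measure.map_id, Measure.map_map hnm (hbf M)]
    have hfun : ((fun W : GaugeConfig 4 (2 * S + 1) G => (nestMul t M (2 * S + 1) W, W)) ∘ blockField M (2 * S + 1)) =
        fun U => (blockField (t * M) (2 * S + 1) U, blockField M (2 * S + 1) U) := by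
      funext U; simp only [Function.comp, blockField_mul (t := t) hM]
    rw [hfun]
  -- assemble
  rw [htarget, ← Measure.map_map hHm hFm, h1, h2, Measure.map_map hHm (hnm.prodMap measurable_id)]
  have hHF : H ∘ Prod.map (fun W => (nestMul t M (2 * S + 1) W, W)) id =
      (Prod.map (nestMul t M (2 * S + 1)) id) ∘ (fun p => (p.1, C p)) := by
    funext p; rfl
  rw [hHF, ← Measure.map_map (hn2.prodMap measurable_id) (measurable_fst.prodMk hC), hClaw,
    Measure.map_map (hn2.prodMap measurable_id) ((hbf M).prodMk measurable_id')]
  have hfun : (Prod.map (nestMul t M (2 * S + 1)) id) ∘ (fun U : GaugeConfig 4 (2 * S + 1) G => (blockField M (2 * S + 1) U, U)) =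
      fun U => (blockField (t * M) (2 * S + 1) U, U) := by
    funext U; simp only [Function.comp, Prod.map, id, blockField_mul (t := t) hM]
  rw [hfun]

end LawStep


/-! ## §S2.3 Laws of the two inputs of the composite; locality predicates; the graded locality step -/

section LocStep

variable {G : Type} [Group G] [TopologicalSpace G] [IsTopologicalGroup G] [CompactSpace G]
  [MeasurableSpace G] [BorelSpace G] [SecondCountableTopology G]

variable {N : ℕ} (ρ : G →* Matrix (Fin N) (Fin N) ℂ) (β : ℝ)

/-- **Law of the lower stage's input.** Under `(blockField 2M)_* μ ⊗ ν`, the pair `(reblock M (B (V, ω_even)), ω_odd)` has law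
`(blockField M)_* μ ⊗ ν` whenever `B` samples the `M`-block field given the `2M`-block field. -/
theorem law_lowerInput {S M t : ℕ} (hM : 0 < M)
    {B : GaugeConfig 4 (2 * S + 1) G × Noise G (2 * S + 1) → GaugeConfig 4 (2 * S + 1) G} (hB : Measurable B)
    (hBlaw : (((wilsonMeasure (d := 4) (L := 2 * S + 1) ρ β).map (blockField (t * M) (2 * S + 1))).prod
        (seqNoise G (2 * S + 1))).map (fun p => (p.1, B p)) =
      (wilsonMeasure (d := 4) (L := 2 * S + 1) ρ β).map
        (fun U => (blockField (t * M) (2 * S + 1) U, blockField M (2 * S + 1) U))) :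
    (((wilsonMeasure (d := 4) (L := 2 * S + 1) ρ β).map (blockField (t * M) (2 * S + 1))).prod
        (seqNoise G (2 * S + 1))).map (fun p => (reblock M (2 * S + 1) (B (p.1, evenPart p.2)), oddPart p.2)) =
      ((wilsonMeasure (d := 4) (L := 2 * S + 1) ρ β).map (blockField M (2 * S + 1))).prod (seqNoise G (2 * S + 1)) := by
  haveI : IsProbabilityMeasure (seqNoise G (2 * S + 1)) := isProbabilityMeasure_seqNoise _
  haveI : SFinite (wilsonMeasure (d := 4) (L := 2 * S + 1) ρ β) := by
    unfold wilsonMeasure wilsonWeight; infer_instance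
  set μ : Measure (GaugeConfig 4 (2 * S + 1) G) := wilsonMeasure (d := 4) (L := 2 * S + 1) ρ β with hμ
  set ν : Measure (Noise G (2 * S + 1)) := seqNoise G (2 * S + 1) with hν
  have hbf : ∀ M', Measurable (blockField (G := G) M' (2 * S + 1)) := fun M' => measurable_blockField M' _
  have hrb : Measurable (reblock (G := G) M (2 * S + 1)) := measurable_reblock _ _
  set g : GaugeConfig 4 (2 * S + 1) G × Noise G (2 * S + 1) → GaugeConfig 4 (2 * S + 1) G :=
    fun p => reblock M (2 * S + 1) (B p) with hg
  have hgm : Measurable g := hrb.comp hB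
  have hFeq : (fun p : GaugeConfig 4 (2 * S + 1) G × Noise G (2 * S + 1) =>
      (reblock M (2 * S + 1) (B (p.1, evenPart p.2)), oddPart p.2)) =
      ((Prod.map g id) ∘ ⇑(MeasurableEquiv.prodAssoc.symm)) ∘ (Prod.map id splitNoise) := by
    funext p; rfl
  have hτ : ((μ.map (blockField (t * M) (2 * S + 1))).prod ν).map g = μ.map (blockField M (2 * S + 1)) := by
    have hg' : g = (fun r : GaugeConfig 4 (2 * S + 1) G × GaugeConfig 4 (2 * S + 1) G => reblock M (2 * S + 1) r.2) ∘
        (fun p => (p.1, B p)) := by funext p; rfl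
    have hrs : Measurable (fun r : GaugeConfig 4 (2 * S + 1) G × GaugeConfig 4 (2 * S + 1) G => reblock M (2 * S + 1) r.2) :=
      hrb.comp measurable_snd
    rw [hg', ← Measure.map_map hrs (measurable_fst.prodMk hB), hBlaw, Measure.map_map hrs ((hbf _).prodMk (hbf _))]
    have hfun : ((fun r : GaugeConfig 4 (2 * S + 1) G × GaugeConfig 4 (2 * S + 1) G => reblock M (2 * S + 1) r.2) ∘
        (fun U : GaugeConfig 4 (2 * S + 1) G => (blockField (t * M) (2 * S + 1) U, blockField M (2 * S + 1) U))) =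
        blockField M (2 * S + 1) := by
      funext U; simp only [Function.comp, reblock_blockField hM]
    rw [hfun]
  rw [hFeq, ← Measure.map_map ((hgm.prodMap measurable_id).comp (MeasurableEquiv.prodAssoc.symm).measurable)
    (measurable_id.prodMap measurable_splitNoise)]
  rw [← Measure.map_prod_map _ _ measurable_id measurable_splitNoise, Measure.map_id, seqNoise_map_splitNoise]
  rw [← Measure.map_map (hgm.prodMap measurable_id) (MeasurableEquiv.prodAssoc.symm).measurable]
  rw [((MeasureTheory.measurePreserving_prodAssoc (μ.map (blockField (t * M) (2 * S + 1))) ν ν).symm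
    MeasurableEquiv.prodAssoc).map_eq]
  rw [← Measure.map_prod_map _ _ hgm measurable_id, Measure.map_id, hτ]

/-- **Law of the upper stage's input**: `(V, ω_even)` has the law of `(V, ω)`. -/
theorem law_upperInput {S M : ℕ} :
    (((wilsonMeasure (d := 4) (L := 2 * S + 1) ρ β).map (blockField M (2 * S + 1))).prod
        (seqNoise G (2 * S + 1))).map (fun p => (p.1, evenPart p.2)) =
      ((wilsonMeasure (d := 4) (L := 2 * S + 1) ρ β).map (blockField M (2 * S + 1))).prod (seqNoise G (2 * S + 1)) := by
  haveI : IsProbabilityMeasure (seqNoise G (2 * S + 1)) := isProbabilityMeasure_seqNoise _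
  haveI : SFinite (wilsonMeasure (d := 4) (L := 2 * S + 1) ρ β) := by
    unfold wilsonMeasure wilsonWeight; infer_instance
  have h : (fun p : GaugeConfig 4 (2 * S + 1) G × Noise G (2 * S + 1) => (p.1, evenPart p.2)) = Prod.map id evenPart := by
    funext p; rfl
  rw [h, ← Measure.map_prod_map _ _ measurable_id measurable_evenPart, Measure.map_id, seqNoise_map_evenPart]

end LocStep
/-! ## §S2.3b Locality predicates and the graded locality step -/

section LocStep

variable {G : Type} [Group G] [TopologicalSpace G] [IsTopologicalGroup G] [CompactSpace G]
  [MeasurableSpace G] [BorelSpace G] [SecondCountableTopology G]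

variable {N : ℕ} (ρ : G →* Matrix (Fin N) (Fin N) ℂ) (β : ℝ)

/-- `f (V, ω)` reads `V` and the link coordinates of `ω` only inside the input ball of radius `R` around `e`
(the locality clause of the conditional formats, named). -/
def LocalAt (S : ℕ) (e : ZdEdge 4) (R : ℕ) (f : GaugeConfig 4 (2 * S + 1) G × Noise G (2 * S + 1) → G) : Prop :=
  ∀ p q : GaugeConfig 4 (2 * S + 1) G × Noise G (2 * S + 1),
    (∀ x ∈ inputBall (2 * S + 1) e R, p.1 x = q.1 x) →
    (∀ y : ℕ × Edge 4 (2 * S + 1), y.2 ∈ inputBall (2 * S + 1) e R → p.2 y = q.2 y) → f p = f q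

omit [TopologicalSpace G] [IsTopologicalGroup G] [CompactSpace G] [MeasurableSpace G] [BorelSpace G]
  [SecondCountableTopology G] in
theorem localAt_mono {S : ℕ} {e : ZdEdge 4} {R R' : ℕ} (h : R ≤ R')
    {f : GaugeConfig 4 (2 * S + 1) G × Noise G (2 * S + 1) → G} (hf : LocalAt S e R f) : LocalAt S e R' f :=
  fun p q h1 h2 => hf p q (fun x hx => h1 x (inputBall_mono e h hx)) (fun y hy => h2 y (inputBall_mono e h hy))

/-- **Graded locality** of a sampler `Ψ` under the input law `π`: for every link and every parameter `s ≥ 1` a measurable local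
surrogate at radius `R s`, wrong with `π`-mass `≤ T s`. -/
def GradedLocal (S : ℕ) (π : Measure (GaugeConfig 4 (2 * S + 1) G × Noise G (2 * S + 1)))
    (Ψ : GaugeConfig 4 (2 * S + 1) G × Noise G (2 * S + 1) → GaugeConfig 4 (2 * S + 1) G) (R : ℕ → ℕ) (T : ℕ → ℝ) : Prop :=
  ∀ (e : ZdEdge 4) (s : ℕ), 1 ≤ s → ∃ Ψ' : GaugeConfig 4 (2 * S + 1) G × Noise G (2 * S + 1) → G, Measurable Ψ' ∧
    LocalAt S e (R s) Ψ' ∧ π {p | Ψ p (torusEdge (2 * S + 1) e) ≠ Ψ' p} ≤ ENNReal.ofReal (T s)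

omit [TopologicalSpace G] [IsTopologicalGroup G] [CompactSpace G] [BorelSpace G] [SecondCountableTopology G] in
theorem gradedLocal_mono {S : ℕ} {π : Measure (GaugeConfig 4 (2 * S + 1) G × Noise G (2 * S + 1))}
    {Ψ : GaugeConfig 4 (2 * S + 1) G × Noise G (2 * S + 1) → GaugeConfig 4 (2 * S + 1) G} {R R' : ℕ → ℕ} {T T' : ℕ → ℝ}
    (hR : ∀ s, 1 ≤ s → R s ≤ R' s) (hT : ∀ s, 1 ≤ s → T s ≤ T' s) (h : GradedLocal S π Ψ R T) : GradedLocal S π Ψ R' T' := by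
  intro e s hs
  obtain ⟨Ψ', hm, hloc, hbad⟩ := h e s hs
  exact ⟨Ψ', hm, localAt_mono (hR s hs) hloc, hbad.trans (ENNReal.ofReal_le_ofReal (hT s hs))⟩

/-- **The graded locality step** (union bound over the `M`-corner links of the lower input ball, counted uniformly in `M`;
the lower stage is run at parameter `s + 4`, the upper stage at `s`). -/
theorem gradedLocal_step {S M b t : ℕ} (hM : 0 < M) (hMN : M ≤ 2 * S + 1) {K : ℝ} (hK : 0 ≤ K)
    {C B : GaugeConfig 4 (2 * S + 1) G × Noise G (2 * S + 1) → GaugeConfig 4 (2 * S + 1) G}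
    (hC : Measurable C) (hB : Measurable B)
    (hBlaw : (((wilsonMeasure (d := 4) (L := 2 * S + 1) ρ β).map (blockField (t * M) (2 * S + 1))).prod
        (seqNoise G (2 * S + 1))).map (fun p => (p.1, B p)) =
      (wilsonMeasure (d := 4) (L := 2 * S + 1) ρ β).map
        (fun U => (blockField (t * M) (2 * S + 1) U, blockField M (2 * S + 1) U)))
    {R₁ : ℕ → ℕ} {T₁ : ℕ → ℝ} (hT₁ : ∀ s, 0 ≤ T₁ s)
    (hCloc : GradedLocal S (((wilsonMeasure (d := 4) (L := 2 * S + 1) ρ β).map (blockField M (2 * S + 1))).prod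
        (seqNoise G (2 * S + 1))) C R₁ T₁)
    (hBloc : ∀ (e : ZdEdge 4) (k : ℕ), 1 ≤ k →
      ∃ B' : GaugeConfig 4 (2 * S + 1) G × Noise G (2 * S + 1) → G, Measurable B' ∧
        LocalAt S e (k * (t * M * b)) B' ∧
        (((wilsonMeasure (d := 4) (L := 2 * S + 1) ρ β).map (blockField (t * M) (2 * S + 1))).prod (seqNoise G (2 * S + 1)))
            {p | B p (torusEdge (2 * S + 1) e) ≠ B' p} ≤ ENNReal.ofReal (K * Real.exp (-(k : ℝ))))
    {R' : ℕ → ℕ} (hR' : ∀ s, R₁ (s + 4) ≤ M * R' s) :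
    GradedLocal S (((wilsonMeasure (d := 4) (L := 2 * S + 1) ρ β).map (blockField (t * M) (2 * S + 1))).prod
        (seqNoise G (2 * S + 1)))
      (fun p => C (reblock M (2 * S + 1) (B (p.1, evenPart p.2)), oddPart p.2))
      (fun s => M * R' s + M + s * (t * M * b))
      (fun s => T₁ (s + 4) + 64 * ((2 * R' s + 3 : ℕ) : ℝ) ^ 4 * (K * Real.exp (-(s : ℝ)))) := by
  classical
  haveI : IsProbabilityMeasure (seqNoise G (2 * S + 1)) := isProbabilityMeasure_seqNoise _
  haveI : NeZero (2 * S + 1) := ⟨by omega⟩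
  intro e s hs
  set π₂ := ((wilsonMeasure (d := 4) (L := 2 * S + 1) ρ β).map (blockField (t * M) (2 * S + 1))).prod
    (seqNoise G (2 * S + 1)) with hπ₂
  set π₁ := ((wilsonMeasure (d := 4) (L := 2 * S + 1) ρ β).map (blockField M (2 * S + 1))).prod
    (seqNoise G (2 * S + 1)) with hπ₁
  -- the lower stage at parameter `s + 4`, weakened to radius `M * R' s`
  obtain ⟨Ψ', hΨ'm, hΨ'loc0, hΨ'bad⟩ := hCloc e (s + 4) (by omega)
  have hΨ'loc : LocalAt S e (M * R' s) Ψ' := localAt_mono (hR' s) hΨ'loc0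
  -- upper surrogates at parameter `s` for every `ℤ⁴`-link
  choose Bap hBapm hBaploc hBapbad using fun e' : ZdEdge 4 => hBloc e' s hs
  -- the corner edges of the lower input ball and their lifts
  obtain ⟨B₂, hB₂⟩ : ∃ B₂ : Set (Edge 4 (2 * S + 1)), B₂ = inputBall (2 * S + 1) e (M * R' s) := ⟨_, rfl⟩
  obtain ⟨Q, hQ⟩ : ∃ Q : Finset (Edge 4 (2 * S + 1)),
      Q = Finset.univ.filter fun q => ∃ x ∈ B₂, cornerEdge M (2 * S + 1) x = q := ⟨_, rfl⟩
  have hQmem : ∀ q ∈ Q, ∃ x ∈ inputBall (2 * S + 1) e (M * R' s), cornerEdge M (2 * S + 1) x = q := by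
    intro q hq
    rw [hQ, Finset.mem_filter] at hq
    obtain ⟨x, hx, hxq⟩ := hq.2
    exact ⟨x, by rwa [hB₂] at hx, hxq⟩
  have hlift : ∀ q ∈ Q, ∃ e₁ : ZdEdge 4, torusEdge (2 * S + 1) e₁ = q ∧ supDist e₁.1 e.1 ≤ M * R' s + M ∧
      IsCornerLift M (2 * S + 1) e₁ := by
    intro q hq
    obtain ⟨x, hx, rfl⟩ := hQmem q hq
    exact exists_cornerLift hM hx
  choose! lift hlift₁ hlift₂ _hlift₃ using hlift
  have hcornerQ : ∀ x ∈ B₂, cornerEdge M (2 * S + 1) x ∈ Q := fun x hx => by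
    rw [hQ, Finset.mem_filter]; exact ⟨Finset.mem_univ _, x, hx, rfl⟩
  have hcard : (Q.card : ℝ) ≤ 64 * ((2 * R' s + 3 : ℕ) : ℝ) ^ 4 := by
    exact_mod_cast card_corners_le hM hMN e (R' s) Q hQmem
  -- the local surrogate of the reblocked upper output
  obtain ⟨W, hW⟩ : ∃ W : GaugeConfig 4 (2 * S + 1) G × Noise G (2 * S + 1) → GaugeConfig 4 (2 * S + 1) G,
      W = fun p x => Bap (lift (cornerEdge M (2 * S + 1) x)) (p.1, evenPart p.2) := ⟨_, rfl⟩
  have hWm : Measurable W := by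
    rw [hW]
    exact measurable_pi_lambda _ fun x => (hBapm _).comp (measurable_fst.prodMk (measurable_evenPart.comp measurable_snd))
  refine ⟨fun p => Ψ' (W p, oddPart p.2), hΨ'm.comp (hWm.prodMk (measurable_oddPart.comp measurable_snd)), ?_, ?_⟩
  · -- locality on the composite ball
    intro p q hV hω
    beta_reduce at hV hω
    refine hΨ'loc (W p, oddPart p.2) (W q, oddPart q.2) (fun x hx => ?_) (fun y hy => ?_)
    · have hxB : x ∈ B₂ := by rw [hB₂]; exact hx
      have hd := hlift₂ _ (hcornerQ x hxB)
      rw [hW]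
      refine hBaploc (lift (cornerEdge M (2 * S + 1) x)) _ _ (fun x' hx' => ?_) (fun y' hy' => ?_)
      · exact hV x' (inputBall_subset (by omega) hx')
      · show p.2 (parityIndex _ (0, y')) = q.2 (parityIndex _ (0, y'))
        refine hω _ ?_
        simp only [parityIndex_snd]
        exact inputBall_subset (by omega) hy'
    · show p.2 (parityIndex _ (1, y)) = q.2 (parityIndex _ (1, y))
      refine hω _ ?_
      simp only [parityIndex_snd]
      exact inputBall_mono e (by omega) hy
  · -- exceptional mass
    have hT : Measurable fun p : GaugeConfig 4 (2 * S + 1) G × Noise G (2 * S + 1) =>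
        (reblock M (2 * S + 1) (B (p.1, evenPart p.2)), oddPart p.2) :=
      ((measurable_reblock M (2 * S + 1)).comp
        (hB.comp (measurable_fst.prodMk (measurable_evenPart.comp measurable_snd)))).prodMk
        (measurable_oddPart.comp measurable_snd)
    have hE : Measurable fun p : GaugeConfig 4 (2 * S + 1) G × Noise G (2 * S + 1) => (p.1, evenPart p.2) :=
      measurable_fst.prodMk (measurable_evenPart.comp measurable_snd)
    have hlawT := law_lowerInput ρ β hM hB hBlaw
    have hlawE := law_upperInput ρ β (S := S) (M := t * M)
    -- pulled-back exceptional events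
    have hbadC : π₂ {p | C (reblock M (2 * S + 1) (B (p.1, evenPart p.2)), oddPart p.2) (torusEdge (2 * S + 1) e) ≠
        Ψ' (reblock M (2 * S + 1) (B (p.1, evenPart p.2)), oddPart p.2)} ≤ ENNReal.ofReal (T₁ (s + 4)) := by
      refine le_trans (Measure.le_map_apply hT.aemeasurable {r | C r (torusEdge (2 * S + 1) e) ≠ Ψ' r}) ?_
      rw [hπ₂, hlawT]
      exact hΨ'bad
    have hbadq : ∀ q ∈ Q, π₂ {p | B (p.1, evenPart p.2) (torusEdge (2 * S + 1) (lift q)) ≠ Bap (lift q) (p.1, evenPart p.2)} ≤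
        ENNReal.ofReal (K * Real.exp (-(s : ℝ))) := by
      intro q _
      refine le_trans (Measure.le_map_apply hE.aemeasurable
        {r | B r (torusEdge (2 * S + 1) (lift q)) ≠ Bap (lift q) r}) ?_
      rw [hπ₂, hlawE]
      exact hBapbad (lift q)
    -- off the exceptional events the composite output is the surrogate
    have hsub : {p | C (reblock M (2 * S + 1) (B (p.1, evenPart p.2)), oddPart p.2) (torusEdge (2 * S + 1) e) ≠
          Ψ' (W p, oddPart p.2)} ⊆
        {p | C (reblock M (2 * S + 1) (B (p.1, evenPart p.2)), oddPart p.2) (torusEdge (2 * S + 1) e) ≠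
          Ψ' (reblock M (2 * S + 1) (B (p.1, evenPart p.2)), oddPart p.2)} ∪
        ⋃ q ∈ Q, {p | B (p.1, evenPart p.2) (torusEdge (2 * S + 1) (lift q)) ≠ Bap (lift q) (p.1, evenPart p.2)} := by
      intro p hp
      by_contra hnot
      simp only [Set.mem_union, Set.mem_iUnion, Set.mem_setOf_eq, not_or, not_exists, not_not] at hnot
      obtain ⟨h1, h2⟩ := hnot
      apply hp
      rw [h1]
      refine hΨ'loc _ _ (fun x hx => ?_) (fun y _ => rfl)
      have hxB : x ∈ B₂ := by rw [hB₂]; exact hx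
      have hq := hcornerQ x hxB
      show B (p.1, evenPart p.2) (cornerEdge M (2 * S + 1) x) = W p x
      rw [hW]
      simp only
      rw [← h2 _ hq, hlift₁ _ hq]
    -- the union bound
    have hKe : 0 ≤ K * Real.exp (-(s : ℝ)) := mul_nonneg hK (Real.exp_pos _).le
    calc π₂ {p | C (reblock M (2 * S + 1) (B (p.1, evenPart p.2)), oddPart p.2) (torusEdge (2 * S + 1) e) ≠
            Ψ' (W p, oddPart p.2)}
        ≤ π₂ {p | C (reblock M (2 * S + 1) (B (p.1, evenPart p.2)), oddPart p.2) (torusEdge (2 * S + 1) e) ≠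
              Ψ' (reblock M (2 * S + 1) (B (p.1, evenPart p.2)), oddPart p.2)} +
          π₂ (⋃ q ∈ Q, {p | B (p.1, evenPart p.2) (torusEdge (2 * S + 1) (lift q)) ≠ Bap (lift q) (p.1, evenPart p.2)}) :=
          (measure_mono hsub).trans (measure_union_le _ _)
      _ ≤ ENNReal.ofReal (T₁ (s + 4)) + Q.card • ENNReal.ofReal (K * Real.exp (-(s : ℝ))) :=
          add_le_add hbadC ((measure_biUnion_finset_le _ _).trans (Finset.sum_le_card_nsmul _ _ _ hbadq))
      _ = ENNReal.ofReal (T₁ (s + 4) + (Q.card : ℝ) * (K * Real.exp (-(s : ℝ)))) := by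
          rw [ENNReal.ofReal_add (hT₁ _) (mul_nonneg (Nat.cast_nonneg _) hKe), ENNReal.ofReal_mul (Nat.cast_nonneg _),
            ENNReal.ofReal_natCast, nsmul_eq_mul]
      _ ≤ ENNReal.ofReal (T₁ (s + 4) + 64 * ((2 * R' s + 3 : ℕ) : ℝ) ^ 4 * (K * Real.exp (-(s : ℝ)))) :=
          ENNReal.ofReal_le_ofReal (by nlinarith [hcard, hKe])

end LocStep


/-! ## §S2.4 Arithmetic of the constants -/

section Arith

theorem exp_four_ge : (54 : ℝ) ≤ Real.exp 4 := by
  have h := Real.exp_one_gt_d9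
  have h1 : Real.exp 4 = (Real.exp 1) ^ 4 := by
    rw [← Real.exp_nat_mul]; norm_num
  have h2 : (2.7182818283 : ℝ) ^ 4 ≤ (Real.exp 1) ^ 4 := pow_le_pow_left₀ (by norm_num) h.le 4
  rw [h1]
  nlinarith [h2]

/-- The tail constant of the graded invariant for block radius `b` and format constant `K' ≥ 0`. -/
def tailConst (b : ℕ) (K' : ℝ) : ℝ := (144 * ((16 * b + 3 : ℕ) : ℝ) ^ 4 + 1) * K'

theorem tailConst_nonneg (b : ℕ) {K' : ℝ} (hK' : 0 ≤ K') : 0 ≤ tailConst b K' := by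
  unfold tailConst; positivity

theorem le_tailConst (b : ℕ) {K' : ℝ} (hK' : 0 ≤ K') : K' ≤ tailConst b K' := by
  unfold tailConst; nlinarith [pow_nonneg (Nat.cast_nonneg (α := ℝ) (16 * b + 3)) 4]

/-- The one-step tail bookkeeping: `A (s+6)^4 e^{-(s+4)} + 64 (4bs+32b+5)^4 K' e^{-s} ≤ A (s+2)^4 e^{-s}` for `s ≥ 1`. -/
theorem tail_step_arith (b : ℕ) {K' : ℝ} (hK' : 0 ≤ K') {s : ℕ} (hs : 1 ≤ s) :
    tailConst b K' * (((s + 4 : ℕ) : ℝ) + 2) ^ 4 * Real.exp (-((s + 4 : ℕ) : ℝ)) +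
        64 * ((2 * (2 * b * s + 16 * b + 1) + 3 : ℕ) : ℝ) ^ 4 * (K' * Real.exp (-(s : ℝ))) ≤
      tailConst b K' * ((s : ℝ) + 2) ^ 4 * Real.exp (-(s : ℝ)) := by
  set A := tailConst b K' with hA
  set F : ℝ := ((16 * b + 3 : ℕ) : ℝ) ^ 4 with hF
  have hA' : A = (144 * F + 1) * K' := rfl
  have hA0 : 0 ≤ A := tailConst_nonneg b hK'
  have hF0 : 0 ≤ F := by positivity
  set E := Real.exp (-(s : ℝ)) with hE
  have hE0 : 0 < E := Real.exp_pos _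
  set e4 := Real.exp (-4) with he4
  have he40 : 0 < e4 := Real.exp_pos _
  have h54 : e4 * 54 ≤ 1 := by
    have hmul : e4 * Real.exp 4 = 1 := by rw [he4, ← Real.exp_add]; norm_num
    nlinarith [exp_four_ge]
  have hexp : Real.exp (-((s + 4 : ℕ) : ℝ)) = E * e4 := by
    rw [hE, he4, ← Real.exp_add]; push_cast; ring_nf
  set X : ℝ := (((s + 4 : ℕ) : ℝ) + 2) ^ 4 with hX
  set Y : ℝ := ((s : ℝ) + 2) ^ 4 with hY
  have hY0 : 0 ≤ Y := by positivity
  have hXY : X ≤ 30 * Y := by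
    have h1 : (3 * (s + 6)) ^ 4 ≤ (7 * (s + 2)) ^ 4 := Nat.pow_le_pow_left (by omega) 4
    have h2 : (((3 * (s + 6)) ^ 4 : ℕ) : ℝ) ≤ (((7 * (s + 2)) ^ 4 : ℕ) : ℝ) := by exact_mod_cast h1
    rw [hX, hY]; push_cast at h2 ⊢; nlinarith [h2]
  set P : ℝ := ((2 * (2 * b * s + 16 * b + 1) + 3 : ℕ) : ℝ) ^ 4 with hP
  have hPY : P ≤ F * Y := by
    have h1 : (2 * (2 * b * s + 16 * b + 1) + 3) ^ 4 ≤ ((16 * b + 3) * (s + 2)) ^ 4 :=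
      Nat.pow_le_pow_left (by nlinarith) 4
    have h2 : (((2 * (2 * b * s + 16 * b + 1) + 3) ^ 4 : ℕ) : ℝ) ≤ ((((16 * b + 3) * (s + 2)) ^ 4 : ℕ) : ℝ) := by
      exact_mod_cast h1
    rw [hP, hF, hY]; push_cast at h2 ⊢; nlinarith [h2]
  have key : A * X * e4 + 64 * P * K' ≤ A * Y := by
    nlinarith [mul_le_mul_of_nonneg_left hXY (by positivity : 0 ≤ A * e4),
      mul_le_mul_of_nonneg_left h54 (by positivity : 0 ≤ A * 30 * Y),
      mul_le_mul_of_nonneg_left hPY (by positivity : 0 ≤ 64 * K')]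
  rw [hexp]
  have hl : A * X * (E * e4) + 64 * P * (K' * E) = E * (A * X * e4 + 64 * P * K') := by ring
  have hr : A * Y * E = E * (A * Y) := by ring
  rw [hl, hr]
  exact mul_le_mul_of_nonneg_left key hE0.le

/-- The final re-indexing `s = 2k`: `A (2k+2)^4 e^{-2k} ≤ 384 e A e^{-k}`. -/
theorem tail_final_arith {A : ℝ} (hA : 0 ≤ A) (k : ℕ) :
    A * (((2 * k : ℕ) : ℝ) + 2) ^ 4 * Real.exp (-((2 * k : ℕ) : ℝ)) ≤ 384 * Real.exp 1 * A * Real.exp (-(k : ℝ)) := by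
  have h4 := pow_four_le_exp (k + 1)
  have hE0 : 0 < Real.exp (-(k : ℝ)) := Real.exp_pos _
  have hsq : Real.exp (-((2 * k : ℕ) : ℝ)) = Real.exp (-(k : ℝ)) * Real.exp (-(k : ℝ)) := by
    rw [← Real.exp_add]; push_cast; ring_nf
  have hk1 : Real.exp (((k + 1 : ℕ) : ℝ)) = Real.exp (k : ℝ) * Real.exp 1 := by
    rw [← Real.exp_add]; push_cast; ring_nf
  have hinv : Real.exp (k : ℝ) * Real.exp (-(k : ℝ)) = 1 := by rw [← Real.exp_add]; simp
  have h16 : (((2 * k : ℕ) : ℝ) + 2) ^ 4 = 16 * (((k + 1 : ℕ) : ℝ)) ^ 4 := by push_cast; ring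
  rw [hsq, h16]
  rw [hk1] at h4
  -- `A * (16 (k+1)^4) * (E * E) ≤ 384 e A E` since `(k+1)^4 E ≤ 24 e`
  have hmid : (((k + 1 : ℕ) : ℝ)) ^ 4 * Real.exp (-(k : ℝ)) ≤ 24 * Real.exp 1 := by
    have := mul_le_mul_of_nonneg_right h4 hE0.le
    calc (((k + 1 : ℕ) : ℝ)) ^ 4 * Real.exp (-(k : ℝ)) ≤ 24 * (Real.exp (k : ℝ) * Real.exp 1) * Real.exp (-(k : ℝ)) := this
      _ = 24 * Real.exp 1 * (Real.exp (k : ℝ) * Real.exp (-(k : ℝ))) := by ring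
      _ = 24 * Real.exp 1 := by rw [hinv, mul_one]
  have := mul_le_mul_of_nonneg_left hmid (by positivity : 0 ≤ 16 * A * Real.exp (-(k : ℝ)))
  nlinarith [this]

end Arith
/-! ## §S2.5 The invariant, base, step, induction, and `IterateCondCoders` -/

section Iterate

variable {G : Type} [Group G] [TopologicalSpace G] [IsTopologicalGroup G] [CompactSpace G]
  [MeasurableSpace G] [BorelSpace G] [SecondCountableTopology G]

omit [Group G] [TopologicalSpace G] [IsTopologicalGroup G] [CompactSpace G] [MeasurableSpace G] [BorelSpace G]
  [SecondCountableTopology G] in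
theorem torusEdge_mem_inputBall {N : ℕ} (e : ZdEdge 4) (R : ℕ) : torusEdge N e ∈ inputBall N e R :=
  ⟨e, by simp [supDist_le_iff], rfl⟩

variable {N : ℕ} (ρ : G →* Matrix (Fin N) (Fin N) ℂ) (β : ℝ)

/-- The induction invariant at block side `M`: a conditional coder of the fine field given its `M`-blocks on the torus `2S+1`,
exact in law, with graded locality radius `M (2bs + 8b + 1)` and tail `A (s+2)^4 e^{-s}`. -/
def Inv (S b : ℕ) (A : ℝ) (M : ℕ) : Prop :=
  ∃ C : GaugeConfig 4 (2 * S + 1) G × Noise G (2 * S + 1) → GaugeConfig 4 (2 * S + 1) G, Measurable C ∧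
    (((wilsonMeasure (d := 4) (L := 2 * S + 1) ρ β).map (blockField M (2 * S + 1))).prod
        (seqNoise G (2 * S + 1))).map (fun p => (p.1, C p)) =
      (wilsonMeasure (d := 4) (L := 2 * S + 1) ρ β).map (fun U => (blockField M (2 * S + 1) U, U)) ∧
    GradedLocal S (((wilsonMeasure (d := 4) (L := 2 * S + 1) ρ β).map (blockField M (2 * S + 1))).prod
        (seqNoise G (2 * S + 1))) C (fun s => M * (2 * b * s + 8 * b + 1)) (fun s => A * ((s : ℝ) + 2) ^ 4 * Real.exp (-(s : ℝ)))

/-- **Base**: the level-`0` conditional coder (fine given `2`-blocks) is the invariant at `M = 2`. -/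
theorem inv_base {S b : ℕ} {K A : ℝ} (hKA : K ≤ A) (hA : 0 ≤ A)
    {Ψ : GaugeConfig 4 (2 * S + 1) G × Noise G (2 * S + 1) → GaugeConfig 4 (2 * S + 1) G} (hΨm : Measurable Ψ)
    (hΨlaw : (((wilsonMeasure (d := 4) (L := 2 * S + 1) ρ β).map (blockField 2 (2 * S + 1))).prod
        (seqNoise G (2 * S + 1))).map (fun p => (p.1, Ψ p)) =
      (wilsonMeasure (d := 4) (L := 2 * S + 1) ρ β).map (fun U => (blockField 2 (2 * S + 1) U, U)))
    (hΨloc : ∀ (e : ZdEdge 4) (k : ℕ), 1 ≤ k →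
      ∃ Ψ' : GaugeConfig 4 (2 * S + 1) G × Noise G (2 * S + 1) → G, Measurable Ψ' ∧
        LocalAt S e (k * (2 * b)) Ψ' ∧
        (((wilsonMeasure (d := 4) (L := 2 * S + 1) ρ β).map (blockField 2 (2 * S + 1))).prod (seqNoise G (2 * S + 1)))
            {p | Ψ p (torusEdge (2 * S + 1) e) ≠ Ψ' p} ≤ ENNReal.ofReal (K * Real.exp (-(k : ℝ)))) :
    Inv ρ β S b A 2 := by
  refine ⟨Ψ, hΨm, hΨlaw, ?_⟩
  intro e s hs
  obtain ⟨Ψ', hm, hloc, hbad⟩ := hΨloc e s hs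
  refine ⟨Ψ', hm, localAt_mono (by nlinarith) hloc, hbad.trans (ENNReal.ofReal_le_ofReal ?_)⟩
  have h1 : (1 : ℝ) ≤ ((s : ℝ) + 2) ^ 4 := one_le_pow₀ (by have := (Nat.cast_nonneg (α := ℝ) s); linarith)
  have hE : 0 < Real.exp (-(s : ℝ)) := Real.exp_pos _
  nlinarith [mul_le_mul_of_nonneg_left h1 hA, hE]

/-- **Step**: the invariant at `M` and a one-step conditional block coder `M ← 2M` give the invariant at `2M`. -/
theorem inv_step {S M b : ℕ} (hM : 0 < M) (hMN : M ≤ 2 * S + 1) {K K' : ℝ} (hK' : 0 ≤ K') (hKK' : K ≤ K')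
    (hInv : Inv ρ β S b (tailConst b K') M)
    {B : GaugeConfig 4 (2 * S + 1) G × Noise G (2 * S + 1) → GaugeConfig 4 (2 * S + 1) G} (hB : Measurable B)
    (hBlaw : (((wilsonMeasure (d := 4) (L := 2 * S + 1) ρ β).map (blockField (2 * M) (2 * S + 1))).prod
        (seqNoise G (2 * S + 1))).map (fun p => (p.1, B p)) =
      (wilsonMeasure (d := 4) (L := 2 * S + 1) ρ β).map
        (fun U => (blockField (2 * M) (2 * S + 1) U, blockField M (2 * S + 1) U)))
    (hBloc : ∀ (e : ZdEdge 4) (k : ℕ), 1 ≤ k →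
      ∃ B' : GaugeConfig 4 (2 * S + 1) G × Noise G (2 * S + 1) → G, Measurable B' ∧
        LocalAt S e (k * (2 * M * b)) B' ∧
        (((wilsonMeasure (d := 4) (L := 2 * S + 1) ρ β).map (blockField (2 * M) (2 * S + 1))).prod (seqNoise G (2 * S + 1)))
            {p | B p (torusEdge (2 * S + 1) e) ≠ B' p} ≤ ENNReal.ofReal (K * Real.exp (-(k : ℝ)))) :
    Inv ρ β S b (tailConst b K') (2 * M) := by
  obtain ⟨C, hC, hClaw, hCloc⟩ := hInv
  have hT : Measurable fun p : GaugeConfig 4 (2 * S + 1) G × Noise G (2 * S + 1) =>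
      (reblock M (2 * S + 1) (B (p.1, evenPart p.2)), oddPart p.2) :=
    ((measurable_reblock M (2 * S + 1)).comp
      (hB.comp (measurable_fst.prodMk (measurable_evenPart.comp measurable_snd)))).prodMk
      (measurable_oddPart.comp measurable_snd)
  refine ⟨fun p => C (reblock M (2 * S + 1) (B (p.1, evenPart p.2)), oddPart p.2), hC.comp hT,
    condLaw_step ρ β hM hC hB hClaw hBlaw, ?_⟩
  -- upper locality with the nonnegative constant `K'`
  have hBloc' : ∀ (e : ZdEdge 4) (k : ℕ), 1 ≤ k →
      ∃ B' : GaugeConfig 4 (2 * S + 1) G × Noise G (2 * S + 1) → G, Measurable B' ∧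
        LocalAt S e (k * (2 * M * b)) B' ∧
        (((wilsonMeasure (d := 4) (L := 2 * S + 1) ρ β).map (blockField (2 * M) (2 * S + 1))).prod (seqNoise G (2 * S + 1)))
            {p | B p (torusEdge (2 * S + 1) e) ≠ B' p} ≤ ENNReal.ofReal (K' * Real.exp (-(k : ℝ))) := by
    intro e k hk
    obtain ⟨B', hm, hloc, hbad⟩ := hBloc e k hk
    exact ⟨B', hm, hloc, hbad.trans (ENNReal.ofReal_le_ofReal (mul_le_mul_of_nonneg_right hKK' (Real.exp_pos _).le))⟩
  have hstep := gradedLocal_step ρ β (b := b) hM hMN hK' hC hB hBlaw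
    (T₁ := fun s => tailConst b K' * ((s : ℝ) + 2) ^ 4 * Real.exp (-(s : ℝ)))
    (fun s => by have := tailConst_nonneg b hK'; positivity) hCloc hBloc'
    (R' := fun s => 2 * b * s + 16 * b + 1) (fun s => le_of_eq (by ring))
  refine gradedLocal_mono (fun s _ => le_of_eq (by ring)) (fun s hs => ?_) hstep
  exact tail_step_arith b hK' hs

/-- **All levels**: from the level-`0` coder and the block coders `2^i ← 2^{i+1}` (`1 ≤ i < n`), the invariant at every `2^m`,
`1 ≤ m ≤ n`, on a torus large enough for all the formats involved. -/
theorem inv_all {S b n : ℕ} {K : ℝ} (hSn : 2 ^ n ≤ 2 * S + 1) (hSb : 2 ^ n * b ≤ 2 * S + 1)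
    (h0 : ∃ Ψ : GaugeConfig 4 (2 * S + 1) G × Noise G (2 * S + 1) → GaugeConfig 4 (2 * S + 1) G, Measurable Ψ ∧
      (((wilsonMeasure (d := 4) (L := 2 * S + 1) ρ β).map (blockField 2 (2 * S + 1))).prod
          (seqNoise G (2 * S + 1))).map (fun p => (p.1, Ψ p)) =
        (wilsonMeasure (d := 4) (L := 2 * S + 1) ρ β).map (fun U => (blockField 2 (2 * S + 1) U, U)) ∧
      ∀ (e : ZdEdge 4) (k : ℕ), 1 ≤ k →
        ∃ Ψ' : GaugeConfig 4 (2 * S + 1) G × Noise G (2 * S + 1) → G, Measurable Ψ' ∧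
          LocalAt S e (k * (2 * b)) Ψ' ∧
          (((wilsonMeasure (d := 4) (L := 2 * S + 1) ρ β).map (blockField 2 (2 * S + 1))).prod (seqNoise G (2 * S + 1)))
              {p | Ψ p (torusEdge (2 * S + 1) e) ≠ Ψ' p} ≤ ENNReal.ofReal (K * Real.exp (-(k : ℝ))))
    (hblk : ∀ i : ℕ, 1 ≤ i → i < n → CondBlockCodedSeq ρ K β (2 ^ i) (2 ^ (i + 1)) b) :
    ∀ m : ℕ, 1 ≤ m → m ≤ n → Inv ρ β S b (tailConst b (max K 0)) (2 ^ m) := by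
  intro m hm hmn
  induction m, hm using Nat.le_induction with
  | base =>
    obtain ⟨Ψ, hΨm, hΨlaw, hΨloc⟩ := h0
    rw [pow_one]
    exact inv_base ρ β ((le_max_left K 0).trans (le_tailConst b (le_max_right K 0)))
      (tailConst_nonneg b (le_max_right K 0)) hΨm hΨlaw hΨloc
  | succ m hm ih =>
    have hmn' : m < n := by omega
    have hIm := ih (by omega)
    -- the block coder `2^m ← 2^{m+1}` on this torus
    have hfmt := hblk m hm hmn'
    have h2S : 2 ^ (m + 1) * b ≤ 2 * S + 1 :=
      le_trans (Nat.mul_le_mul_right b (Nat.pow_le_pow_right (by norm_num) hmn)) hSb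
    obtain ⟨B, hBm, hBlaw, hBloc⟩ := hfmt S h2S
    have hM : 0 < 2 ^ m := pow_pos (by norm_num) m
    have hMN : 2 ^ m ≤ 2 * S + 1 := le_trans (Nat.pow_le_pow_right (by norm_num) (by omega)) hSn
    rw [pow_succ'] at hBlaw hBloc ⊢
    exact inv_step ρ β hM hMN (le_max_right K 0) (le_max_left K 0) hIm hBm hBlaw
      (fun e k hk => hBloc e k hk)

end Iterate


/-! ## §S2.6 The rev-4 statement `IterateCondCoders` (defs VERBATIM from `Lines/smallfield_polymer_coder.lean` rev 4) — PROVED -/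

section Final

section Defs
variable {G : Type} [Group G] [TopologicalSpace G] [IsTopologicalGroup G] [CompactSpace G]
  [MeasurableSpace G] [BorelSpace G]

/-- **CONDITIONAL CODER WITH A TORUS FLOOR `fl`** (rev 4): the tree format `TelescopedCoding.CondCodedSeq ρ K β M b₂` VERBATIM, asked only on
the odd tori `2S+1 ≥ fl` (besides the format's own `2S+1 ≥ M b₂`).  `fl = 0` is the tree format (`condCodedSeqFrom_zero_iff`). -/
def CondCodedSeqFrom (fl : ℕ) {N : ℕ} (ρ : G →* Matrix (Fin N) (Fin N) ℂ) (K : ℝ) (β : ℝ) (M b₂ : ℕ) : Prop :=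
  ∀ S : ℕ, M * b₂ ≤ 2 * S + 1 → fl ≤ 2 * S + 1 →
    ∃ Ψ : GaugeConfig 4 (2 * S + 1) G × Noise G (2 * S + 1) → GaugeConfig 4 (2 * S + 1) G, Measurable Ψ ∧
      (((wilsonMeasure (d := 4) (L := 2 * S + 1) ρ β).map (blockField M (2 * S + 1))).prod
          (seqNoise G (2 * S + 1))).map (fun p => (p.1, Ψ p)) =
        (wilsonMeasure (d := 4) (L := 2 * S + 1) ρ β).map (fun U => (blockField M (2 * S + 1) U, U)) ∧
      ∀ (e : Literature.MathematicalPhysics.QuantumLattice.ZdEdge 4) (k : ℕ), 1 ≤ k →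
        ∃ Ψ' : GaugeConfig 4 (2 * S + 1) G × Noise G (2 * S + 1) → G, Measurable Ψ' ∧
          (∀ p q : GaugeConfig 4 (2 * S + 1) G × Noise G (2 * S + 1),
            (∀ x ∈ inputBall (2 * S + 1) e (k * (M * b₂)), p.1 x = q.1 x) →
            (∀ y : ℕ × Literature.MathematicalPhysics.QuantumFieldTheory.Edge 4 (2 * S + 1),
              y.2 ∈ inputBall (2 * S + 1) e (k * (M * b₂)) → p.2 y = q.2 y) → Ψ' p = Ψ' q) ∧
          (((wilsonMeasure (d := 4) (L := 2 * S + 1) ρ β).map (blockField M (2 * S + 1))).prod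
              (seqNoise G (2 * S + 1))) {p | Ψ p (torusEdge (2 * S + 1) e) ≠ Ψ' p} ≤
            ENNReal.ofReal (K * Real.exp (-(k : ℝ)))

end Defs

/-- **S₂ — ITERATION with level-independent constants** (plumbing M–L, provable now, group- and `β`-blind): a conditional
coder of the fine field given its `2`-blocks and one-step conditional block coders `2^i ← 2^{i+1}` for `1 ≤ i < n`, all
with constants `(K, b)`, compose to a conditional coder of the fine field given its `2^n`-blocks with constants
`(K₃, b₃)` depending on `(K, b)` ONLY.  Plan: exactness by the nesting identities `blockField 2^{i+1} = F ∘ blockField 2^i`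
(seam-exact truncated blocks on odd tori) and disjoint noise sub-sequences per level; locality: level `i` is read at depth
`k_i = k + c (n - i)` with `c > 4 log 2`, so the input radius `Σ_i k_i b 2^{i+1} ≤ 4 (k + 2c) b 2^n` is geometric and the
union bound over the `≤ (C k b 2^{n-i})⁴` level-`i` blocks in the window gives tails `K (C k b)⁴ e^{-k} Σ_m 2^{4m} e^{-c m}`;
re-index `k ↦ 2k`.  Degenerate cases: `n = 0` is the identity coder (`blockField 1 = id`), `n = 1` is monotonicity of the
format in `(K, b)`.  Rev 4: stated with a TORUS FLOOR `fl` carried from hypothesis to conclusion (the composition is pointwise in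
the torus; `fl = 0` is rev 3's statement, `condCodedSeqFrom_zero_iff`). -/
def IterateCondCoders : Prop :=
  ∀ (K : ℝ) (b : ℕ), ∃ (K₃ : ℝ) (b₃ : ℕ),
    ∀ (G : Type) [Group G] [TopologicalSpace G] [IsTopologicalGroup G] [CompactSpace G]
      [MeasurableSpace G] [BorelSpace G] [SecondCountableTopology G] {N : ℕ} (ρ : G →* Matrix (Fin N) (Fin N) ℂ) (β : ℝ) (n fl : ℕ),
      CondCodedSeqFrom fl ρ K β 2 b →
      (∀ i : ℕ, 1 ≤ i → i < n → CondBlockCodedSeq ρ K β (2 ^ i) (2 ^ (i + 1)) b) →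
        CondCodedSeqFrom fl ρ K₃ β (2 ^ n) b₃

/-- **S₂ PROVED — `IterateCondCoders`** (rev 4 stub `stub_iterateCondCoders`): constants `b₃ = 12b + 1`,
`K₃ = 384·e·(144(16b+3)⁴ + 1)·max K 0`. -/
theorem iterateCondCoders_holds : IterateCondCoders := by
  intro K b
  refine ⟨384 * Real.exp 1 * tailConst b (max K 0), 12 * b + 1, ?_⟩
  intro G _ _ _ _ _ _ _ N ρ β n fl h0 hblk S hS hfl
  haveI : NeZero (2 * S + 1) := ⟨by omega⟩
  haveI : IsProbabilityMeasure (seqNoise G (2 * S + 1)) := isProbabilityMeasure_seqNoise _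
  haveI : SFinite (wilsonMeasure (d := 4) (L := 2 * S + 1) ρ β) := by
    unfold wilsonMeasure wilsonWeight; infer_instance
  rcases Nat.eq_zero_or_pos n with rfl | hn
  · -- `n = 0`: the identity coder of the fine field given its `1`-blocks (= itself)
    simp only [pow_zero] at hS ⊢
    have hbf1 : blockField (G := G) 1 (2 * S + 1) = id := funext blockField_one
    refine ⟨fun p => p.1, measurable_fst, ?_, ?_⟩
    · rw [hbf1, Measure.map_id]
      have hcomp : (fun p : GaugeConfig 4 (2 * S + 1) G × Noise G (2 * S + 1) => (p.1, p.1)) =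
          (fun U : GaugeConfig 4 (2 * S + 1) G => (id U, U)) ∘ Prod.fst := rfl
      rw [hcomp, ← Measure.map_map (measurable_id.prodMk measurable_id') measurable_fst, Measure.map_fst_prod,
        measure_univ, one_smul]
    · intro e k hk
      refine ⟨fun p => p.1 (torusEdge (2 * S + 1) e), (measurable_pi_apply (torusEdge (2 * S + 1) e)).comp measurable_fst,
        fun p q hV _ => hV _ (torusEdge_mem_inputBall e _), ?_⟩
      simp
  · -- `n ≥ 1`: the telescoped composite at level `n`, read at parameter `s = 2k`
    have hSn : 2 ^ n ≤ 2 * S + 1 := le_trans (Nat.le_mul_of_pos_right _ (by omega)) hS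
    have hSb : 2 ^ n * b ≤ 2 * S + 1 := le_trans (Nat.mul_le_mul_left (2 ^ n) (by omega)) hS
    have h2n : 2 ≤ 2 ^ n := by
      calc (2 : ℕ) = 2 ^ 1 := (pow_one 2).symm
        _ ≤ 2 ^ n := Nat.pow_le_pow_right (by norm_num) hn
    have h2b : 2 * b ≤ 2 * S + 1 := le_trans (Nat.mul_le_mul_right b h2n) hSb
    obtain ⟨Ψ, hΨm, hΨlaw, hΨloc⟩ := h0 S h2b hfl
    obtain ⟨C, hC, hClaw, hCloc⟩ :=
      inv_all ρ β hSn hSb ⟨Ψ, hΨm, hΨlaw, fun e k hk => hΨloc e k hk⟩ hblk n hn le_rfl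
    refine ⟨C, hC, hClaw, ?_⟩
    intro e k hk
    obtain ⟨Ψ', hm, hloc, hbad⟩ := hCloc e (2 * k) (by omega)
    have hrad : 2 ^ n * (2 * b * (2 * k) + 8 * b + 1) ≤ k * (2 ^ n * (12 * b + 1)) := by
      have h1 : 2 * b * (2 * k) + 8 * b + 1 ≤ k * (12 * b + 1) := by nlinarith
      calc 2 ^ n * (2 * b * (2 * k) + 8 * b + 1) ≤ 2 ^ n * (k * (12 * b + 1)) := Nat.mul_le_mul_left _ h1
        _ = k * (2 ^ n * (12 * b + 1)) := by ring
    refine ⟨Ψ', hm, localAt_mono hrad hloc, hbad.trans (ENNReal.ofReal_le_ofReal ?_)⟩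
    exact tail_final_arith (tailConst_nonneg b (le_max_right K 0)) k

/-! ## §S2.7 C3 (`ComposeCond`, guarded by `1 ≤ M`) — one conditional composition step over a general divisor `M' ∣ M` -/

section C3

/-- The C3 tail at parameter `s = 2k`. -/
theorem tail_c3_arith (b₃ : ℕ) {K₃' K₄' : ℝ} (h3 : 0 ≤ K₃') (h4 : 0 ≤ K₄') {k : ℕ} (hk : 1 ≤ k) :
    K₃' * Real.exp (-((2 * k + 4 : ℕ) : ℝ)) +
        64 * ((2 * ((2 * k + 4) * b₃) + 3 : ℕ) : ℝ) ^ 4 * (K₄' * Real.exp (-((2 * k : ℕ) : ℝ))) ≤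
      (K₃' + 1536 * ((12 * b₃ + 3 : ℕ) : ℝ) ^ 4 * K₄') * Real.exp (-(k : ℝ)) := by
  have hE0 : 0 < Real.exp (-(k : ℝ)) := Real.exp_pos _
  have h1 : Real.exp (-((2 * k + 4 : ℕ) : ℝ)) ≤ Real.exp (-(k : ℝ)) :=
    Real.exp_le_exp.2 (by push_cast; linarith [(Nat.cast_nonneg (α := ℝ) k)])
  have hP : ((2 * ((2 * k + 4) * b₃) + 3 : ℕ) : ℝ) ≤ (k : ℝ) * ((12 * b₃ + 3 : ℕ) : ℝ) := by
    have : (2 * ((2 * k + 4) * b₃) + 3 : ℕ) ≤ k * (12 * b₃ + 3) := by nlinarith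
    exact_mod_cast this
  have hP4 : ((2 * ((2 * k + 4) * b₃) + 3 : ℕ) : ℝ) ^ 4 ≤ (k : ℝ) ^ 4 * ((12 * b₃ + 3 : ℕ) : ℝ) ^ 4 := by
    rw [← mul_pow]; exact pow_le_pow_left₀ (by positivity) hP 4
  have h4k := pow_four_le_exp k
  have hsq : Real.exp (-((2 * k : ℕ) : ℝ)) = Real.exp (-(k : ℝ)) * Real.exp (-(k : ℝ)) := by
    rw [← Real.exp_add]; push_cast; ring_nf
  have hinv : Real.exp (k : ℝ) * Real.exp (-(k : ℝ)) = 1 := by rw [← Real.exp_add]; simp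
  have hmid : (k : ℝ) ^ 4 * Real.exp (-((2 * k : ℕ) : ℝ)) ≤ 24 * Real.exp (-(k : ℝ)) := by
    rw [hsq]
    calc (k : ℝ) ^ 4 * (Real.exp (-(k : ℝ)) * Real.exp (-(k : ℝ)))
        = ((k : ℝ) ^ 4 * Real.exp (-(k : ℝ))) * Real.exp (-(k : ℝ)) := by ring
      _ ≤ (24 * Real.exp (k : ℝ) * Real.exp (-(k : ℝ))) * Real.exp (-(k : ℝ)) :=
          mul_le_mul_of_nonneg_right (mul_le_mul_of_nonneg_right h4k hE0.le) hE0.le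
      _ = 24 * (Real.exp (k : ℝ) * Real.exp (-(k : ℝ))) * Real.exp (-(k : ℝ)) := by ring
      _ = 24 * Real.exp (-(k : ℝ)) := by rw [hinv, mul_one]
  have hQ : 0 ≤ ((12 * b₃ + 3 : ℕ) : ℝ) ^ 4 := by positivity
  have hE2 : 0 ≤ Real.exp (-((2 * k : ℕ) : ℝ)) := (Real.exp_pos _).le
  calc K₃' * Real.exp (-((2 * k + 4 : ℕ) : ℝ)) +
        64 * ((2 * ((2 * k + 4) * b₃) + 3 : ℕ) : ℝ) ^ 4 * (K₄' * Real.exp (-((2 * k : ℕ) : ℝ)))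
      ≤ K₃' * Real.exp (-(k : ℝ)) +
        64 * ((k : ℝ) ^ 4 * ((12 * b₃ + 3 : ℕ) : ℝ) ^ 4) * (K₄' * Real.exp (-((2 * k : ℕ) : ℝ))) := by
          gcongr
    _ = K₃' * Real.exp (-(k : ℝ)) +
        64 * ((12 * b₃ + 3 : ℕ) : ℝ) ^ 4 * K₄' * ((k : ℝ) ^ 4 * Real.exp (-((2 * k : ℕ) : ℝ))) := by ring
    _ ≤ K₃' * Real.exp (-(k : ℝ)) + 64 * ((12 * b₃ + 3 : ℕ) : ℝ) ^ 4 * K₄' * (24 * Real.exp (-(k : ℝ))) := by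
          gcongr
    _ = (K₃' + 1536 * ((12 * b₃ + 3 : ℕ) : ℝ) ^ 4 * K₄') * Real.exp (-(k : ℝ)) := by ring

/-- **C3 PROVED in the form the assembly consumes** (`1 ≤ M'`, `1 ≤ M`, `M' ∣ M`): a conditional coder of the fine field given its
`M'`-blocks (floored, constants `(K₃, b₃)`) and a conditional block coder `M' ← M` (constants `(K₄, b₄)`) compose to a conditional
coder of the fine field given its `M`-blocks with constants `K₂ = max K₃ 0 + 1536 (12 b₃ + 3)⁴ max K₄ 0`, `b₂ = 6 b₃ + 2 b₄ + 1`
depending on `(K₃, K₄, b₃, b₄)` ONLY — by the exact `t`-fold nesting `blockField (t M') = nestMul t M' ∘ blockField M'`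
(`condLaw_step`) and one graded locality step (`gradedLocal_step`) read at parameter `s = 2k`.  The telescoped line's registered
`stub_composeCond` omits the guard `1 ≤ M`; its only consumer (`irCal_of_telescoped`) has `M = 2^{j⋆} ≥ 1`. -/
theorem composeCond_pos (K₃ K₄ : ℝ) (b₃ b₄ : ℕ) : ∃ (K₂ : ℝ) (b₂ : ℕ),
    ∀ (G : Type) [Group G] [TopologicalSpace G] [IsTopologicalGroup G] [CompactSpace G]
      [MeasurableSpace G] [BorelSpace G] [SecondCountableTopology G] {N : ℕ} (ρ : G →* Matrix (Fin N) (Fin N) ℂ) (β : ℝ)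
      (M' M fl : ℕ), 1 ≤ M' → 1 ≤ M → M' ∣ M → CondBlockCodedSeq ρ K₄ β M' M b₄ → CondCodedSeqFrom fl ρ K₃ β M' b₃ →
        CondCodedSeqFrom fl ρ K₂ β M b₂ := by
  refine ⟨max K₃ 0 + 1536 * ((12 * b₃ + 3 : ℕ) : ℝ) ^ 4 * max K₄ 0, 6 * b₃ + 2 * b₄ + 1, ?_⟩
  intro G _ _ _ _ _ _ _ N ρ β M' M fl hM' hM hdvd hblk hcond
  obtain ⟨t, rfl⟩ := hdvd
  rw [Nat.mul_comm M' t] at hM hblk ⊢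
  have ht : 0 < t := by
    rcases Nat.eq_zero_or_pos t with rfl | h
    · simp at hM
    · exact h
  have hM'pos : 0 < M' := hM'
  have hM'le : M' ≤ t * M' := Nat.le_mul_of_pos_left M' ht
  intro S hS hfl
  haveI : NeZero (2 * S + 1) := ⟨by omega⟩
  haveI : IsProbabilityMeasure (seqNoise G (2 * S + 1)) := isProbabilityMeasure_seqNoise _
  haveI : SFinite (wilsonMeasure (d := 4) (L := 2 * S + 1) ρ β) := by
    unfold wilsonMeasure wilsonWeight; infer_instance
  have hSb₄ : t * M' * b₄ ≤ 2 * S + 1 := le_trans (Nat.mul_le_mul_left (t * M') (by omega)) hS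
  have hSb₃ : M' * b₃ ≤ 2 * S + 1 := le_trans (Nat.mul_le_mul hM'le (by omega)) hS
  have hM'S : M' ≤ 2 * S + 1 := le_trans (le_trans hM'le (Nat.le_mul_of_pos_right _ (by omega))) hS
  obtain ⟨B, hBm, hBlaw, hBloc⟩ := hblk S hSb₄
  obtain ⟨C, hCm, hClaw, hCloc⟩ := hcond S hSb₃ hfl
  -- graded form of the lower coder: its format approximant at parameter `s`, constant `max K₃ 0`
  have hCgl : GradedLocal S (((wilsonMeasure (d := 4) (L := 2 * S + 1) ρ β).map (blockField M' (2 * S + 1))).prod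
      (seqNoise G (2 * S + 1))) C (fun s => s * (M' * b₃)) (fun s => max K₃ 0 * Real.exp (-(s : ℝ))) := by
    intro e s hs
    obtain ⟨Ψ', hm, hloc, hbad⟩ := hCloc e s hs
    exact ⟨Ψ', hm, hloc, hbad.trans (ENNReal.ofReal_le_ofReal
      (mul_le_mul_of_nonneg_right (le_max_left _ _) (Real.exp_pos _).le))⟩
  -- upper locality with the nonnegative constant `max K₄ 0`
  have hBloc' : ∀ (e : ZdEdge 4) (k : ℕ), 1 ≤ k →
      ∃ B' : GaugeConfig 4 (2 * S + 1) G × Noise G (2 * S + 1) → G, Measurable B' ∧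
        LocalAt S e (k * (t * M' * b₄)) B' ∧
        (((wilsonMeasure (d := 4) (L := 2 * S + 1) ρ β).map (blockField (t * M') (2 * S + 1))).prod (seqNoise G (2 * S + 1)))
            {p | B p (torusEdge (2 * S + 1) e) ≠ B' p} ≤ ENNReal.ofReal (max K₄ 0 * Real.exp (-(k : ℝ))) := by
    intro e k hk
    obtain ⟨B', hm, hloc, hbad⟩ := hBloc e k hk
    exact ⟨B', hm, hloc, hbad.trans (ENNReal.ofReal_le_ofReal
      (mul_le_mul_of_nonneg_right (le_max_left _ _) (Real.exp_pos _).le))⟩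
  have hstep := gradedLocal_step ρ β (b := b₄) (t := t) hM'pos hM'S (le_max_right K₄ 0) hCm hBm hBlaw
    (R₁ := fun s => s * (M' * b₃)) (T₁ := fun s => max K₃ 0 * Real.exp (-(s : ℝ)))
    (fun s => mul_nonneg (le_max_right _ _) (Real.exp_pos _).le) hCgl hBloc'
    (R' := fun s => (s + 4) * b₃) (fun s => le_of_eq (by ring))
  have hT : Measurable fun p : GaugeConfig 4 (2 * S + 1) G × Noise G (2 * S + 1) =>
      (reblock M' (2 * S + 1) (B (p.1, evenPart p.2)), oddPart p.2) :=
    ((measurable_reblock M' (2 * S + 1)).comp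
      (hBm.comp (measurable_fst.prodMk (measurable_evenPart.comp measurable_snd)))).prodMk
      (measurable_oddPart.comp measurable_snd)
  refine ⟨fun p => C (reblock M' (2 * S + 1) (B (p.1, evenPart p.2)), oddPart p.2), hCm.comp hT,
    condLaw_step ρ β hM'pos hCm hBm hClaw hBlaw, ?_⟩
  intro e k hk
  obtain ⟨Ψ', hm, hloc, hbad⟩ := hstep e (2 * k) (by omega)
  have hrad : M' * ((2 * k + 4) * b₃) + M' + 2 * k * (t * M' * b₄) ≤ k * (t * M' * (6 * b₃ + 2 * b₄ + 1)) := by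
    set P : ℕ := t * M' with hP
    have h1 : M' * ((2 * k + 4) * b₃) ≤ P * (6 * k * b₃) :=
      Nat.mul_le_mul hM'le (Nat.mul_le_mul_right _ (by omega))
    have h2 : M' ≤ k * P := le_trans hM'le (Nat.le_mul_of_pos_left P hk)
    calc M' * ((2 * k + 4) * b₃) + M' + 2 * k * (P * b₄) ≤ P * (6 * k * b₃) + k * P + 2 * k * (P * b₄) := by omega
      _ = k * (P * (6 * b₃ + 2 * b₄ + 1)) := by ring
  refine ⟨Ψ', hm, localAt_mono hrad hloc, hbad.trans (ENNReal.ofReal_le_ofReal ?_)⟩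
  exact tail_c3_arith b₃ (le_max_right K₃ 0) (le_max_right K₄ 0) hk

end C3

end Final

end Summit.QuantumFields.YangMills.Cruxes.IR.SmallFieldPolymerCoder

end
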